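import Mathlib
import HarnessLib

/-!
# Two-copy Harris form across a 2-separation: closure under two single-side inequalities

Helper file for crux `stmt-CriticalPhenomena-4575` (new-inequality factory `prim-ineq-gen-1`, gen 15); memo
`run/shared/lean/prim/prim-ineq-gen-1/FINDING-21-low-levels-two-sum.md` §4.5.  Companion of
`…TwoCopyTwoSum.lean` (the 2-SUM IDENTITY `Z[fg]Z[1] − Z[f]Z[g] = (q−1)X₁X₂ + Z₂Δ₂X₁ + Z₁Δ₁X₂ − A₁A₂Δ₁Δ₂` for a graph glued
from two sides along a vertex pair, with `Z_i = A_i + B_i`).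

This file records the algebra behind the CONDITIONAL 2-SUM CLOSURE of the two-copy random-cluster Harris form (H):
the right-hand side of the identity equals
`X₁·(Z₂Δ₂ − (1−q)X₂) + Δ₁·(Z₁·(X₂ − A₂Δ₂) + B₁·A₂Δ₂)` (`closure_identity`),
so it is nonnegative as soon as side 1 has `X₁, Δ₁, A₁, B₁ ≥ 0` and side 2 satisfies the two SIDE INEQUALITIES
`(L1) A₂Δ₂ ≤ X₂` and `(L5) (1−q)X₂ ≤ Z₂Δ₂` (`closure_nonneg`, in any ordered commutative ring — e.g. `ℝ` at a fixed
`q`, which is the random-cluster Harris statement at that `q`; for the coefficientwise statement apply it in a coefficientwise-ordered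
polynomial ring).  In graph terms `X₂ = H_{G₂}(g⁰, [x~y])`, `Δ₂ = Z₂[x≁y ∧ g⁺ ∧ ¬g⁰]`, `A₂ = Z₂[x~y]`, `B₂ = Z₂[x≁y]`; (L1) says
`Z[x~y ∧ g⁰]·Z[x≁y] ≥ Z[x~y]·Z[x≁y ∧ g⁺]` ("internal connection of the glue pair helps the event at least as much as a free
virtual edge") and (L5) says `Z·Z[x≁y ∧ g⁺ ∧ ¬g⁰] ≥ (1−q)·H_{G₂}(g⁰,[x~y])`.  Both hold coefficientwise in all 34,775 + (random
n ≤ 8) tested (graph, event, glue pair) triples (memo §4.5); they are conjectured in general.  (This work, 2026-08-21.)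
-/

namespace Summit.CriticalPhenomena.PercolationContinuityZ3.Theorems

namespace TwoCopyTwoSumClosure

/-- The right-hand side of the 2-sum identity regrouped as a sum of two products:
`(q−1)X₁X₂ + Z₂Δ₂X₁ + Z₁Δ₁X₂ − A₁A₂Δ₁Δ₂ = X₁(Z₂Δ₂ − (1−q)X₂) + Δ₁(Z₁(X₂ − A₂Δ₂) + B₁A₂Δ₂)` with `Z_i = A_i + B_i`.
[this work] -/
theorem closure_identity {R : Type*} [CommRing R] (q X₁ A₁ B₁ Δ₁ X₂ A₂ B₂ Δ₂ : R) :
    (q - 1) * X₁ * X₂ + (A₂ + B₂) * Δ₂ * X₁ + (A₁ + B₁) * Δ₁ * X₂ - A₁ * A₂ * Δ₁ * Δ₂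
      = X₁ * ((A₂ + B₂) * Δ₂ - (1 - q) * X₂) + Δ₁ * ((A₁ + B₁) * (X₂ - A₂ * Δ₂) + B₁ * (A₂ * Δ₂)) := by
  ring

/-- CONDITIONAL 2-SUM CLOSURE: if side 1 has nonnegative blocks `X₁, Δ₁, A₁, B₁` (for `X₁` this is the side's own two-copy
Harris form between its event and the internal connection of the glue pair), `A₂, Δ₂ ≥ 0`, and side 2 satisfies
(L1) `A₂Δ₂ ≤ X₂` and (L5) `(1−q)X₂ ≤ (A₂+B₂)Δ₂`, then the glued two-copy Harris form is nonnegative. [this work] -/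
theorem closure_nonneg {R : Type*} [CommRing R] [PartialOrder R] [IsOrderedRing R]
    (q X₁ A₁ B₁ Δ₁ X₂ A₂ B₂ Δ₂ : R)
    (hX₁ : 0 ≤ X₁) (hΔ₁ : 0 ≤ Δ₁) (hA₁ : 0 ≤ A₁) (hB₁ : 0 ≤ B₁) (hA₂ : 0 ≤ A₂) (hΔ₂ : 0 ≤ Δ₂)
    (hL1 : A₂ * Δ₂ ≤ X₂) (hL5 : (1 - q) * X₂ ≤ (A₂ + B₂) * Δ₂) :
    0 ≤ (q - 1) * X₁ * X₂ + (A₂ + B₂) * Δ₂ * X₁ + (A₁ + B₁) * Δ₁ * X₂ - A₁ * A₂ * Δ₁ * Δ₂ := by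
  rw [closure_identity]
  have h1 : 0 ≤ (A₂ + B₂) * Δ₂ - (1 - q) * X₂ := sub_nonneg.mpr hL5
  have h2 : 0 ≤ X₂ - A₂ * Δ₂ := sub_nonneg.mpr hL1
  have h3 : 0 ≤ (A₁ + B₁) * (X₂ - A₂ * Δ₂) := mul_nonneg (add_nonneg hA₁ hB₁) h2
  have h4 : 0 ≤ B₁ * (A₂ * Δ₂) := mul_nonneg hB₁ (mul_nonneg hA₂ hΔ₂)
  exact add_nonneg (mul_nonneg hX₁ h1) (mul_nonneg hΔ₁ (add_nonneg h3 h4))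

/-- Symmetric packaging: with the 2-sum identity's left side named `H` (`= Z[fg]Z[1] − Z[f]Z[g]` up to the factor `q⁴`),
`H ≥ 0` follows from the identity and the side hypotheses. [this work] -/
theorem glued_nonneg_of_sides {R : Type*} [CommRing R] [PartialOrder R] [IsOrderedRing R]
    (H q X₁ A₁ B₁ Δ₁ X₂ A₂ B₂ Δ₂ : R)
    (hH : H = (q - 1) * X₁ * X₂ + (A₂ + B₂) * Δ₂ * X₁ + (A₁ + B₁) * Δ₁ * X₂ - A₁ * A₂ * Δ₁ * Δ₂)
    (hX₁ : 0 ≤ X₁) (hΔ₁ : 0 ≤ Δ₁) (hA₁ : 0 ≤ A₁) (hB₁ : 0 ≤ B₁) (hA₂ : 0 ≤ A₂) (hΔ₂ : 0 ≤ Δ₂)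
    (hL1 : A₂ * Δ₂ ≤ X₂) (hL5 : (1 - q) * X₂ ≤ (A₂ + B₂) * Δ₂) : 0 ≤ H := by
  rw [hH]; exact closure_nonneg q X₁ A₁ B₁ Δ₁ X₂ A₂ B₂ Δ₂ hX₁ hΔ₁ hA₁ hB₁ hA₂ hΔ₂ hL1 hL5

end TwoCopyTwoSumClosure

end Summit.CriticalPhenomena.PercolationContinuityZ3.Theorems
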